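import Mathlib
import Summits.ValiantsHypothesis.ValiantsHypothesis.Theorems.LiouvilleSarnakCutRankAlignedWindow
import Summits.ValiantsHypothesis.ValiantsHypothesis.Theorems.LiouvilleSarnakLiouvilleCutRankInterleavedUnbounded

/-!
# Route LiouvilleSarnak — crux `LiouvilleCutRank` (stmt-ValiantsHypothesis-14775):
# SWAP STABILITY — exchanging the roles of one row bit and one column bit costs at most a factor `4` in rank

Every unconditional class of the OPEN crux `LiouvilleCutRank` in the tree is an EXACT pattern class (aligned
windows `R^L C^L`, the interleaved cut `(CR)^n`, periodic patterns with a certificate, …), plus ONE hand-made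
robust version (`…StrayRows`: aligned up to `k` stray rows, by a pigeonhole specific to the aligned shape).
This file proves the general robustness principle behind it, valid for ANY entry function `g` of the bit
vector (nothing about `λ` is used):

* `elim_swap` — exchanging the row index `i` and the column index `j` in the cut (`π ↦ swap(inl i, inr j) ∘ π`)
  replaces the entry at `(r, c)` by the entry at `(r[i ↦ c j], c[j ↦ r i])` of the old matrix.
* ★ `rank_swap_le` — hence the new cut matrix is the sum of the four "partial transposes"
  `D_y · M[r ↦ r[i↦x], c ↦ c[j↦y]] · D'_x` (`x, y ∈ {0,1}`, `D, D'` diagonal `0/1`), each of rank `≤ rank M`: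
  **`rank M_{π'} ≤ 4 · rank M_π`**, and symmetrically `rank M_π ≤ 4 · rank M_{π'}` (`rank_le_four_mul_rank_swap`).
* `rank_swaps_le` / `rank_le_pow_mul_rank_swaps` — `d` successive swaps cost a factor `≤ 4^d` either way.
* ★ `eventually_le_rank_of_swaps` — CLASS CLOSURE: if a family of cuts (any predicate `P n π`) has rank `→ ∞`
  uniformly (`∀ W ∃ n₀ ∀ n ≥ n₀ ∀ π, P n π → W ≤ rank M_π`), then so does the family of all cuts obtained from
  it by at most `d` row/column swaps, for every fixed `d` (use the hypothesis with `4^d W`).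
* Instances for `λ`: `le_rank_of_swaps_of_alignedWindow` (cuts within `d` swaps of a cut containing an aligned
  window `R^L C^L`, `L ≥ L(W, d)` — this contains the stray-rows class and every "aligned window with `≤ d`
  wrong letters" once the defects are paired with opposite letters outside the window) and
  `le_rank_of_swaps_of_interleaved` (cuts within `d` swaps of the bit-interleaving cut `(CR)^n` — a NEW
  unconditional class: the interleaved prototype with boundedly many defects).

Reading for the crux: the set of balanced cut words of rank `< W` at a given level is `4`-Lipschitz in
`log₄ rank` under the swap metric, so every certified pattern certifies a Hamming ball of bounded radius around
it; what stays OPEN is growth of the radius with the pattern (a ball of radius `o(L)` around `R^L C^L` would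
need `rank (aligned, level L) ≥ W · 4^{o(L)}`, i.e. QUANTITATIVE non-automaticity of `λ`, not in the tree).
`LiouvilleCutRank`, `DigitalBilinearLiouville`, `AlgebraicSarnak` stay OPEN; nothing bears on `VP ≠ VNP`.
No definitions.
-/

set_option linter.dupNamespace false

noncomputable section

namespace Summit.ValiantsHypothesis.ValiantsHypothesis.Theorems.LiouvilleSarnakLiouvilleCutRank.SwapStability

open ArithmeticFunction Finset

open Summit.ValiantsHypothesis.ValiantsHypothesis.Theorems.LiouvilleSarnakCutRankAlignedWindow
  (le_rank_of_alignedWindow)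
open Summit.ValiantsHypothesis.ValiantsHypothesis.Theorems.LiouvilleSarnakLiouvilleCutRank.InterleavedUnbounded
  (interleavedCutRank)

/-! ### §1 Two generic rank facts -/

/-- `rank (A + B) ≤ rank A + rank B`. [folklore] -/
theorem rank_add_le_aux {K : Type*} [Field K] {m n : Type*} [Fintype n] (A B : Matrix m n K) :
    (A + B).rank ≤ A.rank + B.rank := by
  unfold Matrix.rank
  rw [Matrix.mulVecLin_add]
  exact (Submodule.finrank_mono (LinearMap.range_add_le _ _)).trans
    (Submodule.finrank_add_le_finrank_add_finrank _ _)

/-- The rank of an arbitrary submatrix (rows and columns selected by any maps) is at most the rank: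
`A.submatrix f g = P A Q` for selection matrices `P, Q`. [folklore] -/
theorem rank_submatrix_le_aux {K : Type*} [Field K] {m₀ n₀ m₁ n₁ : Type*} [Fintype m₀] [Fintype n₀]
    [Fintype m₁] [Fintype n₁] [DecidableEq m₀] [DecidableEq n₀] (A : Matrix m₀ n₀ K)
    (f : m₁ → m₀) (g : n₁ → n₀) : (A.submatrix f g).rank ≤ A.rank := by
  have h1 : A.submatrix f g =
      (1 : Matrix m₀ m₀ K).submatrix f id * A * (1 : Matrix n₀ n₀ K).submatrix id g := by
    ext i j
    simp [Matrix.mul_apply, Matrix.one_apply]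
  rw [h1]
  exact (Matrix.rank_mul_le_left _ _).trans (Matrix.rank_mul_le_right _ _)

/-! ### §2 One swap -/

/-- **Bit bookkeeping of a swap.**  Reading the row/column bit vectors `r, c` through the exchanged cut
`swap(inl i, inr j)` is reading the updated vectors `r[i ↦ c j]`, `c[j ↦ r i]` through the old one.
[folklore] -/
theorem elim_swap {n : ℕ} (r c : Fin n → Bool) (i j : Fin n) (s : Fin n ⊕ Fin n) :
    Sum.elim r c (Equiv.swap (Sum.inl i) (Sum.inr j) s) =
      Sum.elim (Function.update r i (c j)) (Function.update c j (r i)) s := by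
  rcases s with i' | j'
  · by_cases h : i' = i
    · subst h
      simp [Equiv.swap_apply_left]
    · rw [Equiv.swap_apply_of_ne_of_ne (by simp [h]) (by simp)]
      simp [h]
  · by_cases h : j' = j
    · subst h
      simp [Equiv.swap_apply_right]
    · rw [Equiv.swap_apply_of_ne_of_ne (by simp) (by simp [h])]
      simp [h]

/-- ★ **Swap stability of the cut rank.**  For ANY entry function `g` of the `2n` bits and any cut `π`,
exchanging the roles of the row bit `i` and the column bit `j` multiplies the rank of the cut matrix
`(g(bits of (r,c) through π))_{r,c}` by at most `4`: the new matrix is the sum over `x, y ∈ {0,1}` of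
`diag[r i = y] · M[r ↦ r[i↦x], c ↦ c[j↦y]] · diag[c j = x]`, four matrices of rank `≤ rank M`. [folklore] -/
theorem rank_swap_le {n : ℕ} (g : (Fin (2 * n) → Bool) → ℂ) (π : Fin n ⊕ Fin n ≃ Fin (2 * n))
    (i j : Fin n) :
    (Matrix.of fun r c : Fin n → Bool =>
        g (fun k => Sum.elim r c (((Equiv.swap (Sum.inl i) (Sum.inr j)).trans π).symm k))).rank ≤
      4 * (Matrix.of fun r c : Fin n → Bool => g (fun k => Sum.elim r c (π.symm k))).rank := by
  classical
  set M : Matrix (Fin n → Bool) (Fin n → Bool) ℂ :=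
    Matrix.of fun r c : Fin n → Bool => g (fun k => Sum.elim r c (π.symm k)) with hM
  -- entries of the swapped cut matrix are entries of `M` at updated indices
  have hentry : ∀ r c : Fin n → Bool,
      g (fun k => Sum.elim r c (((Equiv.swap (Sum.inl i) (Sum.inr j)).trans π).symm k)) =
        M (Function.update r i (c j)) (Function.update c j (r i)) := by
    intro r c
    simp only [hM, Matrix.of_apply, Equiv.symm_trans_apply, Equiv.symm_swap, elim_swap]
  -- the four partial transposes
  set T : Bool → Bool → Matrix (Fin n → Bool) (Fin n → Bool) ℂ := fun x y =>
    Matrix.of fun r c : Fin n → Bool =>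
      (if r i = y then (1 : ℂ) else 0) * M (Function.update r i x) (Function.update c j y) *
        (if c j = x then (1 : ℂ) else 0) with hT
  have hsum : (Matrix.of fun r c : Fin n → Bool =>
        g (fun k => Sum.elim r c (((Equiv.swap (Sum.inl i) (Sum.inr j)).trans π).symm k))) =
      T false false + T false true + T true false + T true true := by
    ext r c
    rw [Matrix.of_apply, hentry]
    simp only [Matrix.add_apply, hT, Matrix.of_apply]
    cases r i <;> cases c j <;> simp
  have hTle : ∀ x y : Bool, (T x y).rank ≤ M.rank := by
    intro x y
    have hfac : T x y =
        Matrix.diagonal (fun r : Fin n → Bool => if r i = y then (1 : ℂ) else 0) *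
          M.submatrix (fun r => Function.update r i x) (fun c => Function.update c j y) *
          Matrix.diagonal (fun c : Fin n → Bool => if c j = x then (1 : ℂ) else 0) := by
      ext r c
      rw [Matrix.mul_diagonal, Matrix.diagonal_mul, Matrix.submatrix_apply]
      simp only [hT, Matrix.of_apply]
    rw [hfac]
    exact ((Matrix.rank_mul_le_left _ _).trans (Matrix.rank_mul_le_right _ _)).trans
      (rank_submatrix_le_aux M _ _)
  rw [hsum]
  calc (T false false + T false true + T true false + T true true).rank
      ≤ (T false false + T false true + T true false).rank + (T true true).rank := rank_add_le_aux _ _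
    _ ≤ ((T false false + T false true).rank + (T true false).rank) + (T true true).rank :=
        Nat.add_le_add_right (rank_add_le_aux _ _) _
    _ ≤ (((T false false).rank + (T false true).rank) + (T true false).rank) + (T true true).rank :=
        Nat.add_le_add_right (Nat.add_le_add_right (rank_add_le_aux _ _) _) _
    _ ≤ ((M.rank + M.rank) + M.rank) + M.rank :=
        Nat.add_le_add (Nat.add_le_add (Nat.add_le_add (hTle _ _) (hTle _ _)) (hTle _ _)) (hTle _ _)
    _ = 4 * M.rank := by ring

/-- Swapping twice is the identity on cuts. [folklore] -/
theorem swap_trans_swap_trans {n : ℕ} (π : Fin n ⊕ Fin n ≃ Fin (2 * n)) (i j : Fin n) :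
    (Equiv.swap (Sum.inl i) (Sum.inr j)).trans
        ((Equiv.swap (Sum.inl i) (Sum.inr j)).trans π) = π := by
  ext s
  simp [Equiv.swap_apply_self]

/-- **The reverse direction**: `rank M_π ≤ 4 · rank M_{π'}` for the swapped cut `π'` (apply
`rank_swap_le` to `π'`; swapping twice returns `π`). [folklore] -/
theorem rank_le_four_mul_rank_swap {n : ℕ} (g : (Fin (2 * n) → Bool) → ℂ)
    (π : Fin n ⊕ Fin n ≃ Fin (2 * n)) (i j : Fin n) :
    (Matrix.of fun r c : Fin n → Bool => g (fun k => Sum.elim r c (π.symm k))).rank ≤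
      4 * (Matrix.of fun r c : Fin n → Bool =>
        g (fun k => Sum.elim r c (((Equiv.swap (Sum.inl i) (Sum.inr j)).trans π).symm k))).rank := by
  have h := rank_swap_le g ((Equiv.swap (Sum.inl i) (Sum.inr j)).trans π) i j
  rwa [swap_trans_swap_trans] at h

/-! ### §3 Several swaps -/

/-- **`d` swaps cost a factor `≤ 4^d`.**  For a list `L` of (row index, column index) pairs, applied
successively (`L.foldr (fun q e => swap(inl q.1, inr q.2) ∘ e) π`), the rank of the resulting cut matrix is
at most `4^{|L|}` times that of `M_π`. [folklore] -/
theorem rank_swaps_le {n : ℕ} (g : (Fin (2 * n) → Bool) → ℂ) (π : Fin n ⊕ Fin n ≃ Fin (2 * n))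
    (L : List (Fin n × Fin n)) :
    (Matrix.of fun r c : Fin n → Bool => g (fun k => Sum.elim r c
        ((L.foldr (fun q e => (Equiv.swap (Sum.inl q.1) (Sum.inr q.2)).trans e) π).symm k))).rank ≤
      4 ^ L.length * (Matrix.of fun r c : Fin n → Bool => g (fun k => Sum.elim r c (π.symm k))).rank := by
  induction L with
  | nil => simp
  | cons q L ih =>
    rw [List.foldr_cons, List.length_cons, pow_succ]
    calc _ ≤ 4 * (Matrix.of fun r c : Fin n → Bool => g (fun k => Sum.elim r c
          ((L.foldr (fun q e => (Equiv.swap (Sum.inl q.1) (Sum.inr q.2)).trans e) π).symm k))).rank :=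
          rank_swap_le g _ q.1 q.2
      _ ≤ 4 * (4 ^ L.length *
          (Matrix.of fun r c : Fin n → Bool => g (fun k => Sum.elim r c (π.symm k))).rank) :=
          Nat.mul_le_mul_left 4 ih
      _ = 4 ^ L.length * 4 *
          (Matrix.of fun r c : Fin n → Bool => g (fun k => Sum.elim r c (π.symm k))).rank := by ring

/-- **The reverse direction for `d` swaps**: `rank M_π ≤ 4^{|L|} · rank M_{π_L}`. [folklore] -/
theorem rank_le_pow_mul_rank_swaps {n : ℕ} (g : (Fin (2 * n) → Bool) → ℂ)
    (π : Fin n ⊕ Fin n ≃ Fin (2 * n)) (L : List (Fin n × Fin n)) :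
    (Matrix.of fun r c : Fin n → Bool => g (fun k => Sum.elim r c (π.symm k))).rank ≤
      4 ^ L.length * (Matrix.of fun r c : Fin n → Bool => g (fun k => Sum.elim r c
        ((L.foldr (fun q e => (Equiv.swap (Sum.inl q.1) (Sum.inr q.2)).trans e) π).symm k))).rank := by
  induction L with
  | nil => simp
  | cons q L ih =>
    rw [List.foldr_cons, List.length_cons, pow_succ]
    calc _ ≤ 4 ^ L.length * (Matrix.of fun r c : Fin n → Bool => g (fun k => Sum.elim r c
          ((L.foldr (fun q e => (Equiv.swap (Sum.inl q.1) (Sum.inr q.2)).trans e) π).symm k))).rank := ih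
      _ ≤ 4 ^ L.length * (4 * (Matrix.of fun r c : Fin n → Bool => g (fun k => Sum.elim r c
          (((Equiv.swap (Sum.inl q.1) (Sum.inr q.2)).trans
            (L.foldr (fun q e => (Equiv.swap (Sum.inl q.1) (Sum.inr q.2)).trans e) π)).symm k))).rank) :=
          Nat.mul_le_mul_left _ (rank_le_four_mul_rank_swap g _ q.1 q.2)
      _ = _ := by ring

/-! ### §4 Class closure under boundedly many swaps, and two instances for `λ` -/

/-- ★ **Class closure.**  Let `P n π` be any property of cuts and suppose the Liouville cut matrices of
the cuts with `P` have rank `→ ∞` uniformly (`∀ W ∃ n₀ ∀ n ≥ n₀ ∀ π, P n π → W ≤ rank M_π`).  Then for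
every `d`, the same holds for all cuts obtained from a cut with `P` by at most `d` row/column swaps
(take the hypothesis at `4^d W` and divide by `rank_le_pow_mul_rank_swaps`). [this file] -/
theorem eventually_le_rank_of_swaps
    (P : ∀ n : ℕ, (Fin n ⊕ Fin n ≃ Fin (2 * n)) → Prop)
    (h : ∀ W : ℕ, ∃ n₀ : ℕ, ∀ n ≥ n₀, ∀ π : Fin n ⊕ Fin n ≃ Fin (2 * n), P n π →
      W ≤ (Matrix.of fun r c : Fin n → Bool =>
        (((liouville (Nat.ofBits (fun k : Fin (2 * n) => Sum.elim r c (π.symm k)) + 1) : ℤ) : ℂ))).rank)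
    (d W : ℕ) : ∃ n₀ : ℕ, ∀ n ≥ n₀, ∀ π : Fin n ⊕ Fin n ≃ Fin (2 * n), P n π →
      ∀ L : List (Fin n × Fin n), L.length ≤ d →
      W ≤ (Matrix.of fun r c : Fin n → Bool =>
        (((liouville (Nat.ofBits (fun k : Fin (2 * n) => Sum.elim r c
          ((L.foldr (fun q e => (Equiv.swap (Sum.inl q.1) (Sum.inr q.2)).trans e) π).symm k)) + 1) :
            ℤ) : ℂ))).rank := by
  obtain ⟨n₀, hn₀⟩ := h (4 ^ d * W)
  refine ⟨n₀, fun n hn π hP L hL => ?_⟩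
  have h1 := hn₀ n hn π hP
  have h2 := rank_le_pow_mul_rank_swaps
    (fun v : Fin (2 * n) → Bool => (((liouville (Nat.ofBits v + 1)) : ℤ) : ℂ)) π L
  have h3 : 4 ^ L.length ≤ 4 ^ d := Nat.pow_le_pow_right (by norm_num) hL
  have h4 : 4 ^ d * W ≤ 4 ^ d * (Matrix.of fun r c : Fin n → Bool =>
      (((liouville (Nat.ofBits (fun k : Fin (2 * n) => Sum.elim r c
        ((L.foldr (fun q e => (Equiv.swap (Sum.inl q.1) (Sum.inr q.2)).trans e) π).symm k)) + 1) :
          ℤ) : ℂ))).rank :=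
    h1.trans (h2.trans (Nat.mul_le_mul_right _ h3))
  exact Nat.le_of_mul_le_mul_left h4 (by positivity)

/-- **Instance 1: cuts within `d` swaps of an aligned window.**  For all `W, d` there is `L` such that at
every level `n`, every cut obtained by at most `d` row/column swaps from a cut whose word contains `L`
consecutive row positions followed by `L` consecutive column positions has Liouville cut-matrix rank `≥ W`.
(Contains the stray-rows class; an aligned window `R^L C^L` with `≤ d` wrong letters is `≤ d` swaps from an
exact one once each defect is paired with an opposite letter elsewhere.) [this file] -/
theorem le_rank_of_swaps_of_alignedWindow (W d : ℕ) : ∃ L : ℕ, ∀ (n : ℕ)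
    (π : Fin n ⊕ Fin n ≃ Fin (2 * n)) (s : ℕ), s + 2 * L ≤ 2 * n →
    (∀ j : Fin (2 * n), s ≤ (j : ℕ) → (j : ℕ) < s + L → (π.symm j).isLeft = true) →
    (∀ j : Fin (2 * n), s + L ≤ (j : ℕ) → (j : ℕ) < s + 2 * L → (π.symm j).isLeft = false) →
    ∀ Lw : List (Fin n × Fin n), Lw.length ≤ d →
      W ≤ (Matrix.of fun r c : Fin n → Bool =>
        (((liouville (Nat.ofBits (fun k : Fin (2 * n) => Sum.elim r c
          ((Lw.foldr (fun q e => (Equiv.swap (Sum.inl q.1) (Sum.inr q.2)).trans e) π).symm k)) + 1) :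
            ℤ) : ℂ))).rank := by
  obtain ⟨L, hL⟩ := le_rank_of_alignedWindow (4 ^ d * W)
  refine ⟨L, fun n π s hs hrow hcol Lw hLw => ?_⟩
  have h1 := hL n π s hs hrow hcol
  have h2 := rank_le_pow_mul_rank_swaps
    (fun v : Fin (2 * n) → Bool => (((liouville (Nat.ofBits v + 1)) : ℤ) : ℂ)) π Lw
  have h3 : 4 ^ Lw.length ≤ 4 ^ d := Nat.pow_le_pow_right (by norm_num) hLw
  exact Nat.le_of_mul_le_mul_left (h1.trans (h2.trans (Nat.mul_le_mul_right _ h3))) (by positivity)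

/-- **Instance 2 (a new unconditional class): cuts within `d` swaps of the interleaved cut `(CR)^n`.**
For all `W, d` there is `n₀` such that for every `n ≥ n₀`, every cut obtained by at most `d` row/column swaps
from the bit-interleaving cut (`π (inl i) = 2i+1`, `π (inr i) = 2i`) has Liouville cut-matrix rank `≥ W`
(`InterleavedUnbounded.interleavedCutRank` + class closure). [this file] -/
theorem le_rank_of_swaps_of_interleaved (W d : ℕ) : ∃ n₀ : ℕ, ∀ n ≥ n₀,
    ∀ π : Fin n ⊕ Fin n ≃ Fin (2 * n),
    (∀ i : Fin n, (π (Sum.inl i) : ℕ) = 2 * i + 1 ∧ (π (Sum.inr i) : ℕ) = 2 * i) →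
    ∀ L : List (Fin n × Fin n), L.length ≤ d →
      W ≤ (Matrix.of fun r c : Fin n → Bool =>
        (((liouville (Nat.ofBits (fun k : Fin (2 * n) => Sum.elim r c
          ((L.foldr (fun q e => (Equiv.swap (Sum.inl q.1) (Sum.inr q.2)).trans e) π).symm k)) + 1) :
            ℤ) : ℂ))).rank :=
  eventually_le_rank_of_swaps
    (fun n π => ∀ i : Fin n, (π (Sum.inl i) : ℕ) = 2 * i + 1 ∧ (π (Sum.inr i) : ℕ) = 2 * i)
    (fun W' => interleavedCutRank W') d W

end Summit.ValiantsHypothesis.ValiantsHypothesis.Theorems.LiouvilleSarnakLiouvilleCutRank.SwapStability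

end
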